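import Summits.CriticalPhenomena.SAWScalingLimit.Theorems.SAWLoopFugacityFlowSimpleSubseqLimitsTransferLattice
import Summits.CriticalPhenomena.SAWScalingLimit.Theorems.SAWLoopFugacityFlowSimpleSubseqLimitsEndpoints
import Summits.CriticalPhenomena.SAWScalingLimit.Theses.SAWTensorRG
import Mathlib.MeasureTheory.Measure.RegularityCompacts
import HarnessLib

/-!
# Split glue for the crux `SimpleSubseqLimits` (stmt-CriticalPhenomena-4982) on route SAWTensorRG:
# `SeqSlitAvoidance → LimitRangeArc → SimpleSubseqLimits` (crux strategist s2, 2026-08-17)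

The live line `slit-continuous-restriction` (lead c9; `Theorems/…TransferCore.lean`, `…SlitLine.lean`)
proves `SequentialSlitAvoidance → AvoidanceLimit → SAWLoopFugacityFlow.SimpleSubseqLimits`. Its A-side
input is used ONLY through SHAPE — `ν`-a.e. the RANGE of a subsequential limit is a simple arc from `a` to
`b` meeting `∂D` only at `a, b` (`PastShadowing.Main.rangeArc_of_avoidanceValues`, inside
`stub_transferCore` for the admissibility of limit pasts and inside the closing for the boundary clause).
Route SAWTensorRG (the BET route sharing this crux) has no `AvoidanceLimit` item: its A-side
`ConformalAvoidance` is value-free, and SHAPE is NOT free there (a conformally invariant hull family with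
the restriction cocycle is a restriction measure of SOME exponent `α`; its hull is an arc iff `α = 5/8`).
This file therefore re-hosts the soft transfer and the closing on the VALUE-FREE, ORDER-BLIND hypothesis
`LimitRangeArc` (verbatim the line's `RangeArc`, stated here so that the heavy SLE cone of `…PSLine.lean`
is not imported), and lands the split glue

  `SimpleSubseqLimits_of_arcSubs : ⟨SequentialSlitAvoidance, route-file text⟩ →
      ⟨LimitRangeArc, route-file text⟩ → SAWTensorRG.SimpleSubseqLimits`,

consumed by `ledger route edit route-CriticalPhenomena-SAWTensorRG --split SimpleSubseqLimits --glue-by`.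
Both antecedents are written in the route file's vocabulary (Literature / Mathlib names only); the first IS
`Transfer.SequentialSlitAvoidance` (`seqSlitText_iff`, `Iff.rfl`), the second IS `LimitRangeArc`
(`rangeArcText_iff`, `Iff.rfl`). Mathematics: lead c9's `Transfer.exists_cover`, `Transfer.law_conf_le`,
`Transfer.stub_transferCore` and `Line.core_of_farReturnNull` VERBATIM with the SHAPE input `RangeArc` in
place of `rangeArc_of_avoidanceValues hAV` (credit: prover-line-stmt-CriticalPhenomena-4982-c9-0,
p152831 p153003 p153811 p153873 p154999); the six landed stubs `stub_latticeBound`, `stub_prefixTiming`,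
`stub_pastsCompact`, `stub_subArc`, `stub_endpoints` are imported. [folklore]
-/

noncomputable section

open MeasureTheory Filter Topology Set Metric Function
open Literature.Probability.RandomPlanarGeometry Literature.Probability.RandomPlanarGeometry.SAW
open Literature.Probability.LatticeModels
open scoped ENNReal NNReal BoundedContinuousFunction unitInterval

namespace Summit.CriticalPhenomena.SAWScalingLimit.Theorems.SimpleSubseqLimits.SlitRestriction.ArcSplit

open Summit.CriticalPhenomena.SAWScalingLimit.Theorems.SimpleSubseqLimits.Negative
  (WeakLimitAlong SimpleSubseqLimitsCore simpleSubseqLimits_iff_core ae_source_target_range_of_weakLimitAlong)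
open Summit.CriticalPhenomena.SAWScalingLimit.Theorems.SimpleSubseqLimits.MarkedPointRevisit.Passage
  (IsSubseqLimit latticeCurve measure_image_mk_le_limsup_law)
open Summit.CriticalPhenomena.SAWScalingLimit.Theorems.SimpleSubseqLimits.FirstHit.Passage
  (gaussRat countable_gaussRat)
open Summit.CriticalPhenomena.SAWScalingLimit.Theorems.SimpleSubseqLimits.FarPast.Passage
  (farReturnEvent mem_simple_of_forall_notMem_farReturnEvent)
open Summit.CriticalPhenomena.SAWScalingLimit.Theorems.SimpleSubseqLimits.SlitRestriction.Lattice
  (prefixEvent approachEvent LatticeBound stub_latticeBound)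
open Summit.CriticalPhenomena.SAWScalingLimit.Theorems.SimpleSubseqLimits.SlitRestriction.Timing
  (vertexTime PrefixTiming stub_prefixTiming)
open Summit.CriticalPhenomena.SAWScalingLimit.Theorems.SimpleSubseqLimits.SlitRestriction.Pasts
  (truncate pastSet PastsCompact stub_pastsCompact)
open Summit.CriticalPhenomena.SAWScalingLimit.Theorems.SimpleSubseqLimits.SlitRestriction.Arc
  (IsAdmissiblePast SubArc stub_subArc)
open Summit.CriticalPhenomena.SAWScalingLimit.Theorems.SimpleSubseqLimits.SlitRestriction.Endpoints
  (OffTargetFarReturn offTargetFarReturnEvent FarReturnNullOffTarget FarReturnNull stub_endpoints)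
open Summit.CriticalPhenomena.SAWScalingLimit.Theorems.SimpleSubseqLimits.SlitRestriction.Transfer
  (farPast SequentialSlitAvoidance LocallyUniformSlitAvoidance locallyUniform_of_sequential
    farPast_subset_thickening_of_dist_lt Conf isOpen_setOf_conf conf_of_return latticeEvent_of_conf)

/-! ## The value-free SHAPE input -/

/-- **LIMIT RANGE ARC** (SHAPE, order-blind and value-free): under every subsequential weak limit `ν` of
the critical SAW laws, `ν`-a.e. class has the range of a simple arc from `a = D.pt 0` to `b = D.pt 1`
meeting `∂D` only at `a, b`. Verbatim the line's `PastShadowing.Main.RangeArc` (which is derived there from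
the VALUED A-side, `rangeArc_of_avoidanceValues`); declared here so that this file stays outside the SLE
cone. It is a consequence of the crux itself (a simple class has an injective representative). Child item
`LimitRangeArc` of the split of stmt-CriticalPhenomena-4982 on route SAWTensorRG; deliberately untagged
(not a literature fact). -/
def LimitRangeArc : Prop :=
  ∀ (D : DobrushinDomain) (a b : ℝ → Site 2), IsEndpointApprox D a b →
    ∀ (s : ℕ → ℝ) (ν : Measure (CurveClass ℂ)), Tendsto s atTop (𝓝[>] (0 : ℝ)) →
      IsProbabilityMeasure ν → WeakLimitAlong D a b s ν →
        ∀ᵐ c ∂ν, (∃ e : C(I, ℂ), Injective e ∧ range e = c.range ∧ e 0 = D.pt 0 ∧ e 1 = D.pt 1) ∧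
          c.range ∩ frontier D.carrier ⊆ {D.pt 0, D.pt 1}

/-! ## The finite cover of the admissible pasts -/

/-- **Cover of a compact set of admissible pasts.** Under locally uniform slit avoidance, a compact set
`P` of classes with admissible representatives at `B̄(q, ρ)` is covered by finitely many balls
`B(p, ζ_p)`, `p ∈ t ⊆ P`, each carrying a representative `π_p`, a width `ε_p > 0`, a radius
`0 < ζ_p ≤ min (ε_p/4) ζmax` and a mesh threshold `δ_p > 0` such that every first-entrance prefix of
mesh `< δ_p` whose class lies in `B(p, ζ_p)` obeys the conditional bound with `(far_{R'} π_p, ε_p)`.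
[folklore] -/
theorem exists_cover (hU : LocallyUniformSlitAvoidance) {D : DobrushinDomain} {a b : ℝ → Site 2}
    (hab : SAW.IsEndpointApprox D a b) {q : ℂ} {ρ R' : ℝ} (hρ : 0 < ρ) (hρR : ρ < R') {θ : ℝ}
    (hθ : 0 < θ) {ζmax : ℝ} (hζmax : 0 < ζmax) {P : Set (CurveClass ℂ)} (hP : IsCompact P)
    (hadm : ∀ p ∈ P, ∃ π : Curve ℂ, CurveClass.mk π = p ∧ IsAdmissiblePast D π q ρ) :
    ∃ (t : Finset (CurveClass ℂ)) (πr : CurveClass ℂ → Curve ℂ) (εr ζr δr : CurveClass ℂ → ℝ),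
      (∀ p ∈ t, CurveClass.mk (πr p) = p ∧ 0 < εr p ∧ 0 < ζr p ∧ ζr p ≤ εr p / 4 ∧ ζr p ≤ ζmax ∧
        0 < δr p ∧ ∀ δ : ℝ, 0 < δ → δ < δr p → ∀ (t₀ : Site 2) (ω : SAW.DomainSAW D.carrier δ (a δ) t₀),
          meshPoint δ t₀ ∈ closedBall q ρ →
          (∀ x ∈ ω.walk.support.dropLast, meshPoint δ x ∉ closedBall q ρ) →
          ω.curve ∈ ball p (ζr p) →
          SAW.law D.carrier δ (a δ) (b δ) (approachEvent (v := b δ) ω (farPast (πr p) q R') (εr p)) ≤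
            ENNReal.ofReal θ * SAW.law D.carrier δ (a δ) (b δ) (prefixEvent (v := b δ) ω)) ∧
      P ⊆ ⋃ p ∈ t, ball p (ζr p) := by
  have hall : ∀ p ∈ P, ∃ (π : Curve ℂ) (ε ζ δ₀ : ℝ), CurveClass.mk π = p ∧ 0 < ε ∧ 0 < ζ ∧
      ζ ≤ ε / 4 ∧ ζ ≤ ζmax ∧ 0 < δ₀ ∧ ∀ δ : ℝ, 0 < δ → δ < δ₀ →
        ∀ (t₀ : Site 2) (ω : SAW.DomainSAW D.carrier δ (a δ) t₀),
          meshPoint δ t₀ ∈ closedBall q ρ →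
          (∀ x ∈ ω.walk.support.dropLast, meshPoint δ x ∉ closedBall q ρ) →
          ω.curve ∈ ball p ζ →
          SAW.law D.carrier δ (a δ) (b δ) (approachEvent (v := b δ) ω (farPast π q R') ε) ≤
            ENNReal.ofReal θ * SAW.law D.carrier δ (a δ) (b δ) (prefixEvent (v := b δ) ω) := by
    intro p hp
    obtain ⟨π, hπp, hadmπ⟩ := hadm p hp
    obtain ⟨ε, hε, N, hN, hπN, δ₀, hδ₀, hb⟩ := hU D a b hab π q ρ R' hρ hρR hadmπ θ hθ
    rw [hπp] at hπN
    obtain ⟨ξ, hξ, hball⟩ := Metric.isOpen_iff.1 hN p hπN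
    refine ⟨π, ε, min ξ (min (ε / 4) ζmax), δ₀, hπp, hε, lt_min hξ (lt_min (by positivity) hζmax),
      (min_le_right _ _).trans (min_le_left _ _), (min_le_right _ _).trans (min_le_right _ _), hδ₀,
      fun δ hδ hδδ₀ t₀ ω htip hout hmem => hb δ hδ hδδ₀ t₀ ω htip hout ?_⟩
    exact hball (ball_subset_ball (min_le_left _ _) hmem)
  haveI : Nonempty (Curve ℂ) := ⟨Curve.const 0⟩
  choose! πr εr ζr δr hspec using hall
  obtain ⟨t, htP, hcover⟩ := hP.elim_nhds_subcover (fun p => ball p (ζr p))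
    fun p hp => ball_mem_nhds p (hspec p hp).2.2.1
  exact ⟨t, πr, εr, ζr, δr, fun p hp => hspec p (htP p hp), hcover⟩

/-- A finite family of positive reals has a positive lower bound. [folklore] -/
theorem exists_pos_forall_le (t : Finset (CurveClass ℂ)) (f : CurveClass ℂ → ℝ)
    (hf : ∀ p ∈ t, 0 < f p) : ∃ c : ℝ, 0 < c ∧ ∀ p ∈ t, c ≤ f p := by
  rcases t.eq_empty_or_nonempty with rfl | hne
  · exact ⟨1, one_pos, fun p hp => absurd hp (Finset.notMem_empty p)⟩
  · obtain ⟨p₀, hp₀, hmin⟩ := t.exists_min_image f hne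
    exact ⟨f p₀, hf p₀ hp₀, hmin⟩

/-! ## The lattice bound at a fixed mesh -/

/-- **Lattice bound for the squeeze configuration.** At a mesh `δ > 0` with `ρ₀ + δ ≤ ρ`, if every
cover element `p ∈ t` carries a representative `π_p`, guard margin `R' ≤ R - ζ_p`, width margin
`ε' + δ + ζ_p ≤ ε_p`, and the conditional bound for first-entrance prefixes with class in `B(p, ζ_p)`,
then the law of `{Conf ∘ latticeCurve}` (with `N = ⋃ B(p, ζ_p)`) is at most `θ`: by
`latticeEvent_of_conf` and far-past stability the event lies in the event of `LatticeBound` for the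
ASSIGNMENT of each good vertex list to one cover element containing its class. [folklore] -/
theorem law_conf_le (hLB : LatticeBound) {D : DobrushinDomain} {a b : ℝ → Site 2} {q : ℂ}
    {ρ ρ₀ R R' ε' θ δ : ℝ} (hθ : 0 ≤ θ) (hδ : 0 < δ) (hρ₀ : ρ₀ + δ ≤ ρ)
    (t : Finset (CurveClass ℂ)) (πr : CurveClass ℂ → Curve ℂ) (εr ζr : CurveClass ℂ → ℝ)
    (hπ : ∀ p ∈ t, CurveClass.mk (πr p) = p) (hζR : ∀ p ∈ t, R' ≤ R - ζr p)
    (hε' : ∀ p ∈ t, ε' + δ + ζr p ≤ εr p)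
    (hbound : ∀ p ∈ t, ∀ (t₀ : Site 2) (ω : SAW.DomainSAW D.carrier δ (a δ) t₀),
        meshPoint δ t₀ ∈ closedBall q ρ →
        (∀ x ∈ ω.walk.support.dropLast, meshPoint δ x ∉ closedBall q ρ) →
        ω.curve ∈ ball p (ζr p) →
        SAW.law D.carrier δ (a δ) (b δ) (approachEvent (v := b δ) ω (farPast (πr p) q R') (εr p)) ≤
          ENNReal.ofReal θ * SAW.law D.carrier δ (a δ) (b δ) (prefixEvent (v := b δ) ω)) :
    SAW.law D.carrier δ (a δ) (b δ)
        {γ | Conf q ρ ρ₀ R ε' (⋃ p ∈ t, ball p (ζr p)) (latticeCurve γ)} ≤ ENNReal.ofReal θ := by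
  classical
  -- the selection of ONE cover element for each vertex list whose class is covered
  have hsel : ∀ L : List (Site 2), ∃ p : CurveClass ℂ,
      (∃ p' ∈ t, CurveClass.mk (⟨polyline (L.map (meshPoint δ))⟩ : Curve ℂ) ∈ ball p' (ζr p')) →
        p ∈ t ∧ CurveClass.mk (⟨polyline (L.map (meshPoint δ))⟩ : Curve ℂ) ∈ ball p (ζr p) := by
    intro L
    by_cases h : ∃ p' ∈ t, CurveClass.mk (⟨polyline (L.map (meshPoint δ))⟩ : Curve ℂ) ∈ ball p' (ζr p')
    · obtain ⟨p, hp, hm⟩ := h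
      exact ⟨p, fun _ => ⟨hp, hm⟩⟩
    · exact ⟨CurveClass.mk (Curve.const 0), fun h' => absurd h' h⟩
  choose sel hsel using hsel
  refine (measure_mono ?_).trans (hLB D.carrier δ (a δ) (b δ) q ρ θ hθ
    (fun L => ∃ p' ∈ t, CurveClass.mk (⟨polyline (L.map (meshPoint δ))⟩ : Curve ℂ) ∈ ball p' (ζr p'))
    (fun L => farPast (πr (sel L)) q R') (fun L => εr (sel L)) ?_)
  · -- the inclusion of events
    intro γ hγ
    obtain ⟨k, hklen, hk, hkmin, hprefix, htrunc, j, hkj, hjlen, x, hx, hdist⟩ :=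
      latticeEvent_of_conf hδ γ hρ₀ hγ
    have hGood : ∃ p' ∈ t, CurveClass.mk (⟨polyline (((γ.walk.support.take (k + 1))).map
        (meshPoint δ))⟩ : Curve ℂ) ∈ ball p' (ζr p') := by
      obtain ⟨p, hp, hmem⟩ := mem_iUnion₂.1 htrunc
      exact ⟨p, hp, hprefix ▸ hmem⟩
    obtain ⟨hpt, hpball⟩ := hsel _ hGood
    refine ⟨k, hklen, hk, hkmin, hGood, j, hkj, hjlen, ?_⟩
    have hdist' : dist (CurveClass.mk (truncate (latticeCurve γ) (vertexTime k)))
        (CurveClass.mk (πr (sel (γ.walk.support.take (k + 1))))) <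
          ζr (sel (γ.walk.support.take (k + 1))) := by
      rw [hπ _ hpt, ← hprefix]
      exact mem_ball.1 hpball
    obtain ⟨z, hz, hxz⟩ :=
      mem_thickening_iff.1 (farPast_subset_thickening_of_dist_lt hdist' q (hζR _ hpt) hx)
    refine ⟨z, hz, ?_⟩
    have h₁ := dist_triangle (meshPoint δ (γ.walk.getVert j)) x z
    have h₂ := hε' _ hpt
    change dist (meshPoint δ (γ.walk.getVert j)) z < εr (sel (γ.walk.support.take (k + 1)))
    linarith
  · -- the conditional bound for good first-entrance prefixes, through the selected element
    intro t₀ ω htip hout hGood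
    obtain ⟨hpt, hpball⟩ := hsel _ hGood
    exact hbound _ hpt t₀ ω htip hout hpball

/-! ## The soft transfer on the SHAPE input `LimitRangeArc` -/

/-- **THE SOFT TRANSFER on the value-free SHAPE input** (lead c9's `Transfer.stub_transferCore`,
p153873, verbatim with `LimitRangeArc` replacing `rangeArc_of_avoidanceValues hAV`): the four landed helper
statements, sequential slit avoidance and SHAPE give off-target far-return nullity under every
subsequential weak limit of the critical SAW laws. Steps: (1) sequential ⇒ locally uniform; (2) good
classes (`source/target/range`, SHAPE) fill a measurable full-measure set; (3) Ulam tightness gives a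
compact core `K`; (4) the compact set of admissible pasts of `K` and its finite cover by the locally uniform
bound; (5) the event core lies in the OPEN squeeze configuration, portmanteau; (6) the lattice bound with
the one-element assignment; (7) `ν E ≤ α` for every `α > 0`. [folklore] -/
theorem transferCore_of_rangeArc : LatticeBound → PrefixTiming → PastsCompact → SubArc →
    SequentialSlitAvoidance → LimitRangeArc → FarReturnNullOffTarget := by
  intro hLB _hPT hPC hSA hSeq hRA D a b s ν hab hL q r η hr hη
  obtain ⟨hs, hν, hw⟩ := hL
  haveI := hν
  have hU := locallyUniform_of_sequential hSeq
  -- (2) the measurable full-measure set of good classes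
  have hfree := ae_source_target_range_of_weakLimitAlong (ν := ν) hab hs hw
  have hshape := hRA D a b hab s ν hs hν hw
  have hgood : ∀ᵐ c ∂ν, (c.source = D.pt 0 ∧ c.target = D.pt 1 ∧ c.range ⊆ closure D.carrier) ∧
      (∃ e : C(I, ℂ), Injective e ∧ range e = c.range ∧ e 0 = D.pt 0 ∧ e 1 = D.pt 1) ∧
      c.range ∩ frontier D.carrier ⊆ {D.pt 0, D.pt 1} := by
    filter_upwards [hfree, hshape] with c h₁ h₂
    exact ⟨h₁, h₂.1, h₂.2⟩
  obtain ⟨Z, hZsub, hZmeas, hZnull⟩ := exists_measurable_superset_of_null (ae_iff.1 hgood)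
  have hMgood : ∀ c ∈ Zᶜ, (c.source = D.pt 0 ∧ c.target = D.pt 1 ∧ c.range ⊆ closure D.carrier) ∧
      (∃ e : C(I, ℂ), Injective e ∧ range e = c.range ∧ e 0 = D.pt 0 ∧ e 1 = D.pt 1) ∧
      c.range ∩ frontier D.carrier ⊆ {D.pt 0, D.pt 1} := fun c hc =>
    Classical.byContradiction fun h => hc (hZsub h)
  have hMmeas : MeasurableSet Zᶜ := hZmeas.compl
  -- the source of a class in the event is `5r`-far from `q`
  have hsrc : ∀ c ∈ offTargetFarReturnEvent D q r η, c ∈ Zᶜ → 5 * r < dist (D.pt 0) q := by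
    rintro c ⟨γ, hγc, v, T, t', -, -, -, -, hguard, -, -⟩ hc
    have h0 := hguard 0 bot_le
    have hsource : γ 0 = D.pt 0 := by
      have h := (hMgood c hc).1.1
      rwa [← hγc, CurveClass.source_mk] at h
    rwa [hsource] at h0
  -- it suffices to bound by every positive `α`
  suffices hmain : ∀ α : ℝ, 0 < α → ν (offTargetFarReturnEvent D q r η) ≤ ENNReal.ofReal α by
    refine le_antisymm (ENNReal.le_of_forall_pos_le_add fun α hα _ => ?_) zero_le
    rw [zero_add, ← ENNReal.ofReal_coe_nnreal]
    exact hmain α (NNReal.coe_pos.2 hα)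
  intro α hα
  by_cases hfar : 5 * r < dist (D.pt 0) q
  swap
  · -- degenerate centre: the event misses the good set
    calc ν (offTargetFarReturnEvent D q r η) ≤ ν Z := measure_mono fun c hc =>
          Classical.byContradiction fun hcZ => hfar (hsrc c hc hcZ)
      _ ≤ ENNReal.ofReal α := by rw [hZnull]; exact zero_le
  -- (3) radii and the compact core of the good set
  have hα2 : 0 < α / 2 := half_pos hα
  obtain ⟨ρ, hρdef⟩ : ∃ ρ : ℝ, ρ = 3 * r / 2 := ⟨_, rfl⟩
  obtain ⟨ρ₀, hρ₀def⟩ : ∃ ρ₀ : ℝ, ρ₀ = 5 * r / 4 := ⟨_, rfl⟩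
  obtain ⟨ρ₁, hρ₁def⟩ : ∃ ρ₁ : ℝ, ρ₁ = 9 * r / 8 := ⟨_, rfl⟩
  obtain ⟨R, hRdef⟩ : ∃ R : ℝ, R = 4 * r := ⟨_, rfl⟩
  obtain ⟨R', hR'def⟩ : ∃ R' : ℝ, R' = 3 * r := ⟨_, rfl⟩
  obtain ⟨K, hKM, hK, hνK⟩ := hMmeas.exists_isCompact_sdiff_lt (measure_ne_top ν _)
    (ENNReal.ofReal_pos.2 hα2).ne'
  -- (4) the compact set of admissible pasts and its cover
  obtain ⟨hPc, hPshrink⟩ := hPC K hK q (D.pt 1) ρ ρ₁ η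
  have hadm : ∀ p ∈ pastSet K q (D.pt 1) ρ ρ₁ η 0, ∃ π : Curve ℂ, CurveClass.mk π = p ∧
      IsAdmissiblePast D π q ρ := by
    rintro p ⟨γ, w, hγK, htip, -, hfarb, rfl⟩
    obtain ⟨⟨hsource, -, hrange⟩, harc, hfront⟩ := hMgood _ (hKM hγK)
    rw [CurveClass.source_mk] at hsource
    rw [CurveClass.range_mk] at hrange harc hfront
    refine ⟨truncate γ w, rfl, hSA D γ w q ρ harc hfront hsource hrange ?_ ?_ ?_⟩
    · rw [mem_closedBall]
      linarith
    · intro h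
      rw [h] at htip
      linarith
    · intro u hu h
      have h' := hfarb u hu
      rw [h, dist_self] at h'
      linarith
  have hρ : 0 < ρ := by rw [hρdef]; linarith
  have hρR' : ρ < R' := by rw [hρdef, hR'def]; linarith
  obtain ⟨t, πr, εr, ζr, δr, hspec, hcover⟩ :=
    exists_cover hU hab hρ hρR' hα2 (half_pos hr) hPc hadm
  have hNopen : IsOpen (⋃ p ∈ t, ball p (ζr p)) := isOpen_biUnion fun _ _ => isOpen_ball
  obtain ⟨κ, hκ, hκsub⟩ := hPshrink _ hNopen hcover
  obtain ⟨ε', hε', hε'le⟩ := exists_pos_forall_le t (fun p => εr p / 4)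
    fun p hp => by have := (hspec p hp).2.1; positivity
  obtain ⟨δ₁, hδ₁, hδ₁le⟩ := exists_pos_forall_le t δr fun p hp => (hspec p hp).2.2.2.2.2.1
  -- (6) the lattice bound, eventually along `δ → 0⁺`
  have hδ₂ : 0 < min (r / 4) (min ε' δ₁) := lt_min (by linarith) (lt_min hε' hδ₁)
  have hev : ∀ᶠ δ in 𝓝[>] (0 : ℝ), SAW.law D.carrier δ (a δ) (b δ)
      {γ | Conf q ρ ρ₀ R ε' (⋃ p ∈ t, ball p (ζr p)) (latticeCurve γ)} ≤ ENNReal.ofReal (α / 2) := by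
    filter_upwards [Ioo_mem_nhdsGT hδ₂] with δ hδ
    obtain ⟨hδ0, hδlt⟩ := hδ
    have hδr : δ < r / 4 := hδlt.trans_le (min_le_left _ _)
    have hδε : δ < ε' := hδlt.trans_le ((min_le_right _ _).trans (min_le_left _ _))
    have hδδ₁ : δ < δ₁ := hδlt.trans_le ((min_le_right _ _).trans (min_le_right _ _))
    refine law_conf_le (R' := R') hLB hα2.le hδ0 (by rw [hρ₀def, hρdef]; linarith) t πr εr ζr
      (fun p hp => (hspec p hp).1) (fun p hp => ?_) (fun p hp => ?_) fun p hp t₀ ω htip hout hmem => ?_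
    · have := (hspec p hp).2.2.2.2.1
      rw [hR'def, hRdef]
      linarith
    · have h₁ := (hspec p hp).2.2.2.1
      have h₂ := hε'le p hp
      linarith
    · exact (hspec p hp).2.2.2.2.2.2 δ hδ0 (hδδ₁.trans_le (hδ₁le p hp)) t₀ ω htip hout hmem
  -- (5) the event core lies in the open squeeze configuration
  have hsub : offTargetFarReturnEvent D q r η ∩ K ⊆
      CurveClass.mk '' {γ | Conf q ρ ρ₀ R ε' (⋃ p ∈ t, ball p (ζr p)) γ} := by
    rintro c ⟨⟨γ, hγc, v, T, t', -, hTt, hT, -, hguard, hret, hoff⟩, hcK⟩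
    refine ⟨γ, conf_of_return (ρ₁ := ρ₁) (κ := κ) hTt hT hguard hret (by rw [hρ₁def]; linarith)
      (by rw [hρ₁def, hρ₀def]; linarith) (by rw [hρ₀def, hρdef]; linarith) (by rw [hρdef]; linarith)
      (by rw [hRdef]; linarith) hε' hκ fun w' _ hwT hdw hfarq => ?_, hγc⟩
    refine hκsub ⟨γ, w', hγc ▸ hcK, hdw.le, hfarq, fun u hu => hoff u (hu.trans hwT), rfl⟩
  -- (7) assemble
  have hport := measure_image_mk_le_limsup_law hs hw
    (isOpen_setOf_conf q ρ ρ₀ R ε' (⋃ p ∈ t, ball p (ζr p)) hNopen)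
  have hcore : ν (offTargetFarReturnEvent D q r η ∩ K) ≤ ENNReal.ofReal (α / 2) :=
    (measure_mono hsub).trans (hport.trans (limsup_le_of_le (by isBoundedDefault) hev))
  have hsplit : offTargetFarReturnEvent D q r η ⊆
      (offTargetFarReturnEvent D q r η ∩ K ∪ (Zᶜ \ K)) ∪ Z := by
    intro c hc
    by_cases hcZ : c ∈ Z
    · exact Or.inr hcZ
    · by_cases hcK : c ∈ K
      · exact Or.inl (Or.inl ⟨hc, hcK⟩)
      · exact Or.inl (Or.inr ⟨hcZ, hcK⟩)
  calc ν (offTargetFarReturnEvent D q r η)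
      ≤ ν ((offTargetFarReturnEvent D q r η ∩ K ∪ (Zᶜ \ K)) ∪ Z) := measure_mono hsplit
    _ ≤ ν (offTargetFarReturnEvent D q r η ∩ K) + ν (Zᶜ \ K) + ν Z :=
        (measure_union_le _ _).trans (add_le_add (measure_union_le _ _) le_rfl)
    _ ≤ ENNReal.ofReal (α / 2) + ENNReal.ofReal (α / 2) + 0 :=
        add_le_add (add_le_add hcore hνK.le) (le_of_eq hZnull)
    _ = ENNReal.ofReal α := by
        rw [add_zero, ← ENNReal.ofReal_add hα2.le hα2.le, add_halves]

/-! ## Closing (proved): far-return nullity + SHAPE give the core of the crux -/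

/-- **Far-return nullity and SHAPE give the CORE of the crux** (`Negative.SimpleSubseqLimitsCore`:
`ν`-a.e. simple ∧ boundary clause) — lead c9's `Line.core_of_farReturnNull` (p154999) verbatim with the
boundary clause read off `LimitRangeArc` instead of `rangeArc_of_avoidanceValues hAV`. Simplicity `ν`-a.e.:
the countably many far-return events with Gaussian-rational centre and positive rational radius are null,
endpoints `a ≠ b` are free (`Negative.ae_source_target_range_of_weakLimitAlong`), and the guarded
Rohde–Schramm closing `FarPast.Passage.mem_simple_of_forall_notMem_farReturnEvent` applies. [folklore] -/
theorem core_of_farReturnNull_rangeArc (hN : FarReturnNull) (hRA : LimitRangeArc) :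
    SimpleSubseqLimitsCore := by
  intro D a b hab s ν hs hν hw
  haveI := hν
  have hL : IsSubseqLimit D a b s ν := ⟨hs, hν, hw⟩
  have hfree := ae_source_target_range_of_weakLimitAlong (ν := ν) hab hs hw
  haveI : Countable gaussRat := countable_gaussRat.to_subtype
  have hnull : ∀ᵐ c ∂ν, ∀ q : gaussRat, ∀ r : {x : ℚ // 0 < x},
      c ∉ farReturnEvent (q : ℂ) (r : ℚ) := by
    rw [ae_all_iff]; intro q
    rw [ae_all_iff]; intro r
    have hr : (0 : ℝ) < ((r : ℚ) : ℝ) := by exact_mod_cast r.2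
    exact measure_eq_zero_iff_ae_notMem.1 (hN D a b s ν hab hL q _ hr)
  have hshape := hRA D a b hab s ν hs hν hw
  filter_upwards [hfree, hnull, hshape] with c hc hn h2
  refine ⟨mem_simple_of_forall_notMem_farReturnEvent c (fun q hq r hr => ?_) ?_, h2.2⟩
  · exact hn ⟨q, hq⟩ ⟨r, hr⟩
  · rw [hc.1, hc.2.1]
    exact fun h => absurd (D.pt_injective h) (by decide)

/-- **Route-neutral composition on the SHAPE input**: sequential slit avoidance and `LimitRangeArc` give
the core of the crux, through the five landed stubs `stub_latticeBound`, `stub_prefixTiming`,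
`stub_pastsCompact`, `stub_subArc`, `stub_endpoints` and the re-hosted transfer. [folklore] -/
theorem core_of_seqSlitAvoidance_rangeArc (h₁ : SequentialSlitAvoidance) (h₂ : LimitRangeArc) :
    SimpleSubseqLimitsCore :=
  core_of_farReturnNull_rangeArc (stub_endpoints (transferCore_of_rangeArc stub_latticeBound
    stub_prefixTiming stub_pastsCompact stub_subArc h₁ h₂)) h₂

/-- The two route decls of the shared item stmt-CriticalPhenomena-4982 are the same proposition
(definitional). [folklore] -/
theorem tensorRG_iff_loopFugacityFlow :
    Summit.CriticalPhenomena.SAWScalingLimit.Theses.SAWTensorRG.SimpleSubseqLimits ↔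
      Summit.CriticalPhenomena.SAWScalingLimit.Theses.SAWLoopFugacityFlow.SimpleSubseqLimits :=
  Iff.rfl

/-- **The crux of route SAWTensorRG from the two inputs** (by name). [folklore] -/
theorem tensorRG_of_seqSlitAvoidance_rangeArc (h₁ : SequentialSlitAvoidance) (h₂ : LimitRangeArc) :
    Summit.CriticalPhenomena.SAWScalingLimit.Theses.SAWTensorRG.SimpleSubseqLimits :=
  tensorRG_iff_loopFugacityFlow.2 (simpleSubseqLimits_iff_core.2 (core_of_seqSlitAvoidance_rangeArc h₁ h₂))

/-! ## Read-backs of the route-file texts (definitional) and the split glue BY TEXT -/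

/-- The route-file text of the child `SeqSlitAvoidance` IS `Transfer.SequentialSlitAvoidance`
(registered read-back stub `seqSlitText_iff`). [folklore] -/
theorem seqSlitText_iff : (∀ (D : Literature.Probability.RandomPlanarGeometry.DobrushinDomain) (a b : ℝ → Literature.Probability.LatticeModels.Site 2), Literature.Probability.RandomPlanarGeometry.SAW.IsEndpointApprox D a b → ∀ (π : Literature.Probability.RandomPlanarGeometry.Curve ℂ) (q : ℂ) (ρ R : ℝ), 0 < ρ → ρ < R → ((π 1 ∈ Metric.closedBall q ρ) ∧ Set.range (fun u : unitInterval => π u) ⊆ closure D.carrier ∧ ∃ e : C(unitInterval, ℂ), Function.Injective e ∧ Set.range e = Set.range (fun u : unitInterval => π u) ∧ e 0 = D.pt 0 ∧ ∀ u : unitInterval, e u ∈ frontier D.carrier → u = 0) → ∀ θ : ℝ, 0 < θ → ∃ ε : ℝ, 0 < ε ∧ ∀ (s : ℕ → ℝ) (t : ℕ → Literature.Probability.LatticeModels.Site 2) (ω : ∀ n : ℕ, Literature.Probability.RandomPlanarGeometry.SAW.DomainSAW D.carrier (s n) (a (s n)) (t n)), Filter.Tendsto s Filter.atTop (nhdsWithin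 0 (Set.Ioi 0)) → (∀ n : ℕ, Literature.Probability.LatticeModels.meshPoint (s n) (t n) ∈ Metric.closedBall q ρ) → (∀ n : ℕ, ∀ x ∈ (ω n).walk.support.dropLast, Literature.Probability.LatticeModels.meshPoint (s n) x ∉ Metric.closedBall q ρ) → Filter.Tendsto (fun n => (ω n).curve) Filter.atTop (nhds (Literature.Probability.RandomPlanarGeometry.CurveClass.mk π)) → ∀ᶠ n in Filter.atTop, Literature.Probability.RandomPlanarGeometry.SAW.law D.carrier (s n) (a (s n)) (b (s n)) {γ : Literature.Probability.RandomPlanarGeometry.SAW.DomainSAW D.carrier (s n) (a (s n)) (b (s n)) | γ.walk.support.take ((ω n).length + 1) = (ω n).walk.support ∧ ∃ j : ℕ, (ω n).length ≤ j ∧ j ≤ γ.length ∧ ∃ z ∈ ((fun u : unitInterval => π u) '' {u : unitInterval | ∀ u' : unitInterval, u' ≤ u → R < dist (π u') q}), dist (Literature.Probability.LatticeModels.meshPoint (s n) (γ.walk.getVert j)) z < ε} ≤ ENNReal.ofReal θ * Literature.Probability.RandomPlanarGeometry.SAW.law D.carrier (s n) (a (s n)) (b (s n)) {γ : Literature.Probability.RandomPlanarGeometry.SAW.DomainSAW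 D.carrier (s n) (a (s n)) (b (s n)) | γ.walk.support.take ((ω n).length + 1) = (ω n).walk.support}) ↔ SequentialSlitAvoidance :=
  Iff.rfl

/-- The route-file text of the child `LimitRangeArc` IS `LimitRangeArc`. [folklore] -/
theorem rangeArcText_iff : (∀ (D : Literature.Probability.RandomPlanarGeometry.DobrushinDomain) (a b : ℝ → Literature.Probability.LatticeModels.Site 2), Literature.Probability.RandomPlanarGeometry.SAW.IsEndpointApprox D a b → ∀ (s : ℕ → ℝ) (ν : MeasureTheory.Measure (Literature.Probability.RandomPlanarGeometry.CurveClass ℂ)), Filter.Tendsto s Filter.atTop (nhdsWithin 0 (Set.Ioi 0)) → MeasureTheory.IsProbabilityMeasure ν → (∀ f : BoundedContinuousFunction (Literature.Probability.RandomPlanarGeometry.CurveClass ℂ) ℝ, Filter.Tendsto (fun n => ∫ γ, f γ.curve ∂(Literature.Probability.RandomPlanarGeometry.SAW.law D.carrier (s n) (a (s n)) (b (s n)))) Filter.atTop (nhds (∫ x, f x ∂ν))) → ∀ᵐ γ ∂ν, (∃ e : C(unitInterval, ℂ), Function.Injective e ∧ Set.range e = γ.range ∧ e 0 = D.pt 0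 ∧ e 1 = D.pt 1) ∧ γ.range ∩ frontier D.carrier ⊆ {D.pt 0, D.pt 1}) ↔ LimitRangeArc :=
  Iff.rfl

/-- **SPLIT GLUE** for `ledger route edit route-CriticalPhenomena-SAWTensorRG --split SimpleSubseqLimits
--glue-by`: child 1 (`SeqSlitAvoidance`, ORDER: conditional first-entrance far-slit avoidance, sequentially
continuous in the admissible limit past — research-open, shared with the live line's `stub_seqSlitAvoidance`)
→ child 2 (`LimitRangeArc`, SHAPE: value-free, order-blind; on this route the seat of the exponent
identification `α = 5/8`) → the crux BY NAME. [folklore] -/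
theorem SimpleSubseqLimits_of_arcSubs : (∀ (D : Literature.Probability.RandomPlanarGeometry.DobrushinDomain) (a b : ℝ → Literature.Probability.LatticeModels.Site 2), Literature.Probability.RandomPlanarGeometry.SAW.IsEndpointApprox D a b → ∀ (π : Literature.Probability.RandomPlanarGeometry.Curve ℂ) (q : ℂ) (ρ R : ℝ), 0 < ρ → ρ < R → ((π 1 ∈ Metric.closedBall q ρ) ∧ Set.range (fun u : unitInterval => π u) ⊆ closure D.carrier ∧ ∃ e : C(unitInterval, ℂ), Function.Injective e ∧ Set.range e = Set.range (fun u : unitInterval => π u) ∧ e 0 = D.pt 0 ∧ ∀ u : unitInterval, e u ∈ frontier D.carrier → u = 0) → ∀ θ : ℝ, 0 < θ → ∃ ε : ℝ, 0 < ε ∧ ∀ (s : ℕ → ℝ) (t : ℕ → Literature.Probability.LatticeModels.Site 2) (ω : ∀ n : ℕ, Literature.Probability.RandomPlanarGeometry.SAW.DomainSAW D.carrier (s n) (a (s n)) (t n)), Filter.Tendsto s Filter.atTop (nhdsWithin 0 (Set.Ioi 0)) → (∀ n : ℕ, Literature.Probability.LatticeModels.meshPoint (s n) (t n) ∈ Metric.closedBall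 q ρ) → (∀ n : ℕ, ∀ x ∈ (ω n).walk.support.dropLast, Literature.Probability.LatticeModels.meshPoint (s n) x ∉ Metric.closedBall q ρ) → Filter.Tendsto (fun n => (ω n).curve) Filter.atTop (nhds (Literature.Probability.RandomPlanarGeometry.CurveClass.mk π)) → ∀ᶠ n in Filter.atTop, Literature.Probability.RandomPlanarGeometry.SAW.law D.carrier (s n) (a (s n)) (b (s n)) {γ : Literature.Probability.RandomPlanarGeometry.SAW.DomainSAW D.carrier (s n) (a (s n)) (b (s n)) | γ.walk.support.take ((ω n).length + 1) = (ω n).walk.support ∧ ∃ j : ℕ, (ω n).length ≤ j ∧ j ≤ γ.length ∧ ∃ z ∈ ((fun u : unitInterval => π u) '' {u : unitInterval | ∀ u' : unitInterval, u' ≤ u → R < dist (π u') q}), dist (Literature.Probability.LatticeModels.meshPoint (s n) (γ.walk.getVert j)) z < ε} ≤ ENNReal.ofReal θ * Literature.Probability.RandomPlanarGeometry.SAW.law D.carrier (s n) (a (s n)) (b (s n)) {γ : Literature.Probability.RandomPlanarGeometry.SAW.DomainSAW D.carrier (s n) (a (s n)) (b (s n)) | γ.walk.support.take ((ω n).length +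 1) = (ω n).walk.support}) → (∀ (D : Literature.Probability.RandomPlanarGeometry.DobrushinDomain) (a b : ℝ → Literature.Probability.LatticeModels.Site 2), Literature.Probability.RandomPlanarGeometry.SAW.IsEndpointApprox D a b → ∀ (s : ℕ → ℝ) (ν : MeasureTheory.Measure (Literature.Probability.RandomPlanarGeometry.CurveClass ℂ)), Filter.Tendsto s Filter.atTop (nhdsWithin 0 (Set.Ioi 0)) → MeasureTheory.IsProbabilityMeasure ν → (∀ f : BoundedContinuousFunction (Literature.Probability.RandomPlanarGeometry.CurveClass ℂ) ℝ, Filter.Tendsto (fun n => ∫ γ, f γ.curve ∂(Literature.Probability.RandomPlanarGeometry.SAW.law D.carrier (s n) (a (s n)) (b (s n)))) Filter.atTop (nhds (∫ x, f x ∂ν))) → ∀ᵐ γ ∂ν, (∃ e : C(unitInterval, ℂ), Function.Injective e ∧ Set.range e = γ.range ∧ e 0 = D.pt 0 ∧ e 1 = D.pt 1) ∧ γ.range ∩ frontier D.carrier ⊆ {D.pt 0, D.pt 1}) →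
    Summit.CriticalPhenomena.SAWScalingLimit.Theses.SAWTensorRG.SimpleSubseqLimits :=
  fun h₁ h₂ => tensorRG_of_seqSlitAvoidance_rangeArc (seqSlitText_iff.1 h₁) (rangeArcText_iff.1 h₂)


/-- **SHAPE is a consequence of the crux** (the child `LimitRangeArc` loses nothing): a simple class has an
injective representative with the same range and endpoints. [folklore] -/
theorem rangeArc_of_tensorRG
    (h : Summit.CriticalPhenomena.SAWScalingLimit.Theses.SAWTensorRG.SimpleSubseqLimits) :
    LimitRangeArc := by
  intro D a b hab s ν hs hν hw
  filter_upwards [h D a b hab s ν hs hν hw] with c hc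
  obtain ⟨hsimple, hsrc, htgt, -, hfront⟩ := hc
  refine ⟨?_, hfront⟩
  obtain ⟨γ, hγ, rfl⟩ := hsimple
  refine ⟨γ.toContinuousMap, fun x y hxy => hγ (by simpa using hxy), ?_, ?_, ?_⟩
  · simp only [Curve.coe_toContinuousMap, CurveClass.range_mk]
    rfl
  · rw [CurveClass.source_mk] at hsrc
    simpa [Curve.source] using hsrc
  · rw [CurveClass.target_mk] at htgt
    simpa [Curve.target] using htgt

end Summit.CriticalPhenomena.SAWScalingLimit.Theorems.SimpleSubseqLimits.SlitRestriction.ArcSplit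

end
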